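import Summits.HodgeConjecture.HodgeConjecture.Theorems.MilnorKExponentialSymbolLiftRCupStepDefs
import HarnessLib

/-!
# Cup step for `SymbolLiftR` (route `MilnorKExponential`), I: the cup product of Milnor symbol cocycles

Helper file for the stub `stub_cupStep` (S3) of the line `lefschetz-fold` of the crux `SymbolLiftR`
(item stmt-HodgeConjecture-18702). With the product of chains `mulChain` of the companion file
`…CupStepDefs`:

* chains of good tuples are stable under the product, and the naive Milnor relations
  (`Literature.Geometry.Kaehler.milnorRel`: locality, multilinearity, Steinberg; Milnor (1971), §11)
  are a two-sided ideal for it (`mulChain_mem_milnorRel_of_left/right`: generators go to generators,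
  slotwise);
* Milnor symbol cocycles refine along a refinement of the cover (`isMilnorSymbolCocycle_comap`);
* the Leibniz rule `δ(x ∪ y) = δx ∪ y + (-1)^a x ∪ δy` for the Čech cup product
  `(x ∪ y)_J = x_{J₀…J_a} · y_{J_a J_{a+1}}` with a `1`-cochain (`symbolδ_cupChain`, Bott–Tu (1982),
  §8), whence **the cup product of Milnor symbol cocycles is a Milnor symbol cocycle**
  (`isMilnorSymbolCocycle_cupChain`);
* **symbol forms multiply**: `symbolForm (s · u) = symbolForm s ∧ symbolForm u`
  (`symbolForm_mulChain`: the iterated `dlog` wedge peels off its last factor).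

Everything is proved; no definitions, no named facts.

## References

* R. Bott, L. W. Tu, *Differential Forms in Algebraic Topology* (1982), §8 (8.4).
* J. Milnor, *Introduction to Algebraic K-Theory* (1971), §11, Thm. 11.1.
* M. Green, P. Griffiths, *On the Tangent Space to the Space of Algebraic Cycles on a Smooth Algebraic
  Variety* (2005), §6.3 (6.37).
-/

noncomputable section

-- the mandated namespace `Summit.HodgeConjecture.HodgeConjecture.…` repeats a component
set_option linter.dupNamespace false

open scoped Manifold ContDiff

namespace Summit.HodgeConjecture.HodgeConjecture.Theorems.SymbolLiftR

open Literature.Geometry.Kaehler Literature.NumberTheory.Transcendental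
open Literature.AlgebraicGeometry.Modules

namespace CupStep

section Chains

variable {M : Type*} {E : Type*} [NormedAddCommGroup E] [NormedSpace ℂ E] [TopologicalSpace M]
  [ChartedSpace E M]

/-! ### Chains of good tuples and Milnor relations are stable under the product -/

/-- Appending a unit to a good tuple gives a good tuple. [folklore] -/
theorem isGoodTuple_snoc {W : Set M} {p : ℕ} {t : Fin p → M → ℂ} (ht : IsGoodTuple E W t) {g : M → ℂ}
    (hg : IsHolUnitOn E W g) : IsGoodTuple E W (Fin.snoc t g : Fin (p + 1) → M → ℂ) := by
  intro i
  induction i using Fin.lastCases with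
  | last => simpa only [Fin.snoc_last] using hg
  | cast i => simpa only [Fin.snoc_castSucc] using ht i

/-- **The product of chains of good tuples is a chain of good tuples.** [folklore] -/
theorem mulChain_mem_goodChains {W : Set M} {p : ℕ} {s : (Fin p → M → ℂ) →₀ ℤ}
    (hs : s ∈ goodChains E W p) {u : (Fin 1 → M → ℂ) →₀ ℤ} (hu : u ∈ goodChains E W 1) :
    mulChain p s u ∈ goodChains E W (p + 1) := by
  unfold mulChain Finsupp.sum
  exact sum_mem fun t ht ↦ sum_mem fun g hg ↦
    single_mem_goodChains (isGoodTuple_snoc (hs t ht) ((hu g hg) 0)) _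

/-- A relation in the first `p` slots times a good one-tuple is a relation in weight `p + 1`
(the generators go to generators: same slot, read through `Fin.castSucc`). [cite: Milnor1972, §11 Thm. 11.1] -/
theorem mulChain_single_mem_milnorRel_of_left {W : Set M} {p : ℕ} {s : (Fin p → M → ℂ) →₀ ℤ}
    (hs : s ∈ milnorRel E W p) {g : Fin 1 → M → ℂ} (hg : IsGoodTuple E W g) (b : ℤ) :
    mulChain p s (Finsupp.single g b) ∈ milnorRel E W (p + 1) := by
  induction hs using AddSubgroup.closure_induction with
  | mem s h =>
    rcases h with (⟨t, t', ht, ht', h, rfl⟩ | ⟨t, i, f, ht, hf, rfl⟩) | ⟨t, i, j, ht, hij, h, rfl⟩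
    · rw [mulChain_sub_left, mulChain_single_single, mulChain_single_single, one_mul,
        single_eq_zsmul _ b, single_eq_zsmul (Fin.snoc t' (g 0) : Fin (p + 1) → M → ℂ) b, ← smul_sub]
      refine AddSubgroup.zsmul_mem _ (single_sub_single_mem_milnorRel (isGoodTuple_snoc ht (hg 0))
        (isGoodTuple_snoc ht' (hg 0)) fun i x hx ↦ ?_) b
      induction i using Fin.lastCases with
      | last => simp only [Fin.snoc_last]
      | cast i => simpa only [Fin.snoc_castSucc] using h i x hx
    · rw [mulChain_sub_left, mulChain_sub_left, mulChain_single_single, mulChain_single_single,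
        mulChain_single_single, one_mul]
      have key := multilinear_mem_milnorRel (isGoodTuple_snoc ht (hg 0)) (Fin.castSucc i) hf
      rw [Fin.snoc_castSucc, ← Fin.snoc_update, ← Fin.snoc_update] at key
      rw [single_eq_zsmul _ b, single_eq_zsmul (Fin.snoc t (g 0) : Fin (p + 1) → M → ℂ) b,
        single_eq_zsmul (Fin.snoc (Function.update t i f) (g 0) : Fin (p + 1) → M → ℂ) b,
        ← smul_sub, ← smul_sub]
      exact AddSubgroup.zsmul_mem _ key b
    · rw [mulChain_single_single, one_mul, single_eq_zsmul _ b]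
      refine AddSubgroup.zsmul_mem _ (steinberg_mem_milnorRel (isGoodTuple_snoc ht (hg 0))
        (i := Fin.castSucc i) (j := Fin.castSucc j) (fun e ↦ hij (Fin.castSucc_injective _ e))
        fun x hx ↦ ?_) b
      simpa only [Fin.snoc_castSucc] using h x hx
  | zero => rw [mulChain_zero_left]; exact zero_mem _
  | add a c _ _ ha hc => rw [mulChain_add_left]; exact add_mem ha hc
  | neg a _ ha => rw [mulChain_neg_left]; exact neg_mem ha

/-- **A relation in the first `p` slots times a chain of good one-tuples is a relation.**
[cite: Milnor1972, §11 Thm. 11.1] -/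
theorem mulChain_mem_milnorRel_of_left {W : Set M} {p : ℕ} {s : (Fin p → M → ℂ) →₀ ℤ}
    (hs : s ∈ milnorRel E W p) {u : (Fin 1 → M → ℂ) →₀ ℤ} (hu : u ∈ goodChains E W 1) :
    mulChain p s u ∈ milnorRel E W (p + 1) := by
  rw [← Finsupp.sum_single u, Finsupp.sum, mulChain_sum_right]
  exact sum_mem fun g hg ↦ mulChain_single_mem_milnorRel_of_left hs (hu g hg) (u g)

/-- A good `p`-tuple times a relation of weight one is a relation in weight `p + 1` (the generators
go to generators in the last slot). [cite: Milnor1972, §11 Thm. 11.1] -/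
theorem mulChain_single_mem_milnorRel_of_right {W : Set M} {p : ℕ} {t : Fin p → M → ℂ}
    (ht : IsGoodTuple E W t) (a : ℤ) {u : (Fin 1 → M → ℂ) →₀ ℤ} (hu : u ∈ milnorRel E W 1) :
    mulChain p (Finsupp.single t a) u ∈ milnorRel E W (p + 1) := by
  induction hu using AddSubgroup.closure_induction with
  | mem u h =>
    rcases h with (⟨g, g', hg, hg', h, rfl⟩ | ⟨g, i, f, hg, hf, rfl⟩) | ⟨g, i, j, -, hij, -, -⟩
    · rw [mulChain_sub_right, mulChain_single_single, mulChain_single_single, mul_one,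
        single_eq_zsmul _ a, single_eq_zsmul (Fin.snoc t (g' 0) : Fin (p + 1) → M → ℂ) a, ← smul_sub]
      refine AddSubgroup.zsmul_mem _ (single_sub_single_mem_milnorRel (isGoodTuple_snoc ht (hg 0))
        (isGoodTuple_snoc ht (hg' 0)) fun i x hx ↦ ?_) a
      induction i using Fin.lastCases with
      | last => simpa only [Fin.snoc_last] using h 0 x hx
      | cast i => simp only [Fin.snoc_castSucc]
    · obtain rfl : i = 0 := Subsingleton.elim _ _
      rw [mulChain_sub_right, mulChain_sub_right, mulChain_single_single, mulChain_single_single,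
        mulChain_single_single, mul_one, Function.update_self, Function.update_self]
      have key := multilinear_mem_milnorRel (isGoodTuple_snoc ht (hg 0)) (Fin.last p) hf
      rw [Fin.snoc_last, Fin.update_snoc_last, Fin.update_snoc_last] at key
      rw [single_eq_zsmul _ a, single_eq_zsmul (Fin.snoc t (g 0) : Fin (p + 1) → M → ℂ) a,
        single_eq_zsmul (Fin.snoc t f : Fin (p + 1) → M → ℂ) a, ← smul_sub, ← smul_sub]
      exact AddSubgroup.zsmul_mem _ key a
    · exact absurd (Subsingleton.elim i j) hij
  | zero => rw [mulChain_zero_right]; exact zero_mem _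
  | add b c _ _ hb hc => rw [mulChain_add_right]; exact add_mem hb hc
  | neg b _ hb => rw [mulChain_neg_right]; exact neg_mem hb

/-- **A chain of good `p`-tuples times a relation of weight one is a relation.**
[cite: Milnor1972, §11 Thm. 11.1] -/
theorem mulChain_mem_milnorRel_of_right {W : Set M} {p : ℕ} {s : (Fin p → M → ℂ) →₀ ℤ}
    (hs : s ∈ goodChains E W p) {u : (Fin 1 → M → ℂ) →₀ ℤ} (hu : u ∈ milnorRel E W 1) :
    mulChain p s u ∈ milnorRel E W (p + 1) := by
  rw [← Finsupp.sum_single s, Finsupp.sum, mulChain_sum_left]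
  exact sum_mem fun t ht ↦ mulChain_single_mem_milnorRel_of_right (hs t ht) (s t) hu

/-! ### Reindexing and the cup product of Milnor symbol cocycles -/

/-- **Milnor symbol cocycles refine**: re-indexing a Milnor symbol cocycle of `U` along a refinement
`V_k ⊆ U_{f k}` gives a Milnor symbol cocycle of `V` (good tuples and relations are antitone in the
open set; the Čech differential commutes with re-indexing). [folklore] -/
theorem isMilnorSymbolCocycle_comap {ι κ : Type*} {n p : ℕ} {U : ι → Set M}
    {σ : (Fin (n + 1) → ι) → ((Fin p → M → ℂ) →₀ ℤ)} (hσ : IsMilnorSymbolCocycle E U σ)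
    {V : κ → Set M} (f : κ → ι) (hf : ∀ k, V k ⊆ U (f k)) :
    IsMilnorSymbolCocycle E V fun J ↦ σ (f ∘ J) :=
  ⟨fun J ↦ goodChains_antitone (cechSet_subset_cechSet_comp hf J) p (hσ.1 (f ∘ J)),
    fun J' ↦ milnorRel_antitone (cechSet_subset_cechSet_comp hf J') p (hσ.2 (f ∘ J'))⟩

omit [TopologicalSpace M] [ChartedSpace E M] in
/-- **Leibniz rule for the Čech cup product** `(x ∪ y)_J = x_{J₀…J_a} · y_{J_a J_{a+1}}` of a cochain
of chains (front face) with a `1`-cochain of chains (back edge): `δ(x ∪ y) = δx ∪ y + (-1)^a x ∪ δy`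
(Bott–Tu (1982), §8; the standard front-face/back-face computation). [cite: BottTu1982Forms, §8 (8.4)] -/
theorem symbolδ_cupChain {κ : Type*} {a p : ℕ} (x : (Fin (a + 1) → κ) → ((Fin p → M → ℂ) →₀ ℤ))
    (y : (Fin 2 → κ) → ((Fin 1 → M → ℂ) →₀ ℤ)) (J' : Fin (a + 3) → κ) :
    symbolδ (fun J : Fin (a + 2) → κ ↦ mulChain p (x (J ∘ Fin.castSucc)) (y (Cech.back a J))) J' =
      mulChain p (symbolδ x (J' ∘ Fin.castSucc)) (y (Cech.back (a + 1) J')) +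
        ((-1 : ℤ) ^ a) • mulChain p (x ((J' ∘ Fin.castSucc) ∘ Fin.castSucc))
          (symbolδ y (Cech.backThree a J')) := by
  rw [symbolδ_apply, symbolδ_apply, symbolδ_apply, mulChain_sum_left, mulChain_sum_right,
    Fin.sum_univ_castSucc, Fin.sum_univ_castSucc, Fin.sum_univ_castSucc (n := a + 1),
    Fin.sum_univ_three]
  simp only [mulChain_zsmul_left, mulChain_zsmul_right, front_comp_succAbove_castSucc,
    Cech.back_comp_succAbove_castSucc_castSucc, back_succ_eq_backThree,
    back_comp_succAbove_castSucc_last, back_comp_castSucc, Fin.succAbove_last, Fin.val_castSucc,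
    Fin.val_last, Fin.val_zero, Fin.val_one, Fin.val_two, pow_zero, one_smul, pow_one, smul_add,
    smul_smul]
  have h1 : ((-1 : ℤ) ^ (a + 1)) = -(-1) ^ a := by rw [pow_succ, mul_neg_one]
  have h2 : ((-1 : ℤ) ^ (a + 1 + 1)) = (-1) ^ a := by rw [pow_succ, h1, neg_mul_neg, mul_one]
  have h3 : ((-1 : ℤ) ^ a * (-1)) = -(-1) ^ a := mul_neg_one _
  have h4 : ((-1 : ℤ) ^ a * (-1) ^ 2) = (-1) ^ a := by rw [neg_one_sq, mul_one]
  rw [h1, h2, h3, h4]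
  simp only [neg_smul]
  abel

/-- **The cup product of Milnor symbol cocycles is a Milnor symbol cocycle** (of the sum of the
weights): its components are chains of good tuples on `V_J` (antitone), and `δ(x ∪ y) = δx ∪ y ±
x ∪ δy` lies in the Milnor relations because these are stable under multiplication by good chains
on either side. [cite: BottTu1982Forms, §8 (8.4)] [cite: Milnor1972, §11 Thm. 11.1] -/
theorem isMilnorSymbolCocycle_cupChain {κ : Type*} {a p : ℕ} {V : κ → Set M}
    {x : (Fin (a + 1) → κ) → ((Fin p → M → ℂ) →₀ ℤ)} {y : (Fin 2 → κ) → ((Fin 1 → M → ℂ) →₀ ℤ)}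
    (hx : IsMilnorSymbolCocycle E V x) (hy : IsMilnorSymbolCocycle E V y) :
    IsMilnorSymbolCocycle E V
      fun J : Fin (a + 2) → κ ↦ mulChain p (x (J ∘ Fin.castSucc)) (y (Cech.back a J)) := by
  refine ⟨fun J ↦ ?_, fun J' ↦ ?_⟩
  · exact mulChain_mem_goodChains
      (goodChains_antitone (cechSet_subset_comp V J Fin.castSucc) p (hx.1 (J ∘ Fin.castSucc)))
      (goodChains_antitone (cechSet_subset_comp V J (Fin.natAdd a (m := 2))) 1 (hy.1 (Cech.back a J)))
  · rw [symbolδ_cupChain x y J']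
    refine add_mem ?_ (AddSubgroup.zsmul_mem _ ?_ _)
    · exact mulChain_mem_milnorRel_of_left
        (milnorRel_antitone (cechSet_subset_comp V J' Fin.castSucc) p (hx.2 (J' ∘ Fin.castSucc)))
        (goodChains_antitone (cechSet_subset_comp V J' (Fin.natAdd (a + 1) (m := 2))) 1
          (hy.1 (Cech.back (a + 1) J')))
    · exact mulChain_mem_milnorRel_of_right
        (goodChains_antitone (cechSet_subset_comp V J' (Fin.castSucc ∘ Fin.castSucc)) p
          (hx.1 ((J' ∘ Fin.castSucc) ∘ Fin.castSucc)))
        (milnorRel_antitone (cechSet_subset_comp V J' (Fin.natAdd a (m := 3))) 1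
          (hy.2 (Cech.backThree a J')))

/-! ### Symbol forms multiply -/

/-- In weight one `dlogWedge E 1 (g) = dlog g` (the leading `1 ∧` is invisible,
`one_wedge_eq_self`). [folklore] -/
theorem dlogWedge_one_eq (g : Fin 1 → M → ℂ) : dlogWedge E 1 g = dlog E (g 0) := by
  rw [dlogWedge_succ, dlogWedge_zero]
  funext x
  exact one_wedge_eq_self (V := E) (dlog E (g 0) x)

/-- Symbol forms multiply on single tuples:
`dlog f₁ ∧ ⋯ ∧ dlog f_p ∧ dlog g = (dlog f₁ ∧ ⋯ ∧ dlog f_p) ∧ dlog g` (`dlogWedge_succ`). [folklore] -/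
theorem symbolForm_mulChain_single_single (p : ℕ) (t : Fin p → M → ℂ) (a : ℤ) (g : Fin 1 → M → ℂ)
    (b : ℤ) :
    symbolForm E (p + 1) (mulChain p (Finsupp.single t a) (Finsupp.single g b)) =
      (symbolForm E p (Finsupp.single t a)).wedge (symbolForm E 1 (Finsupp.single g b)) := by
  rw [mulChain_single_single, symbolForm_single, symbolForm_single, symbolForm_single, dlogWedge_succ,
    dlogWedge_one_eq]
  simp only [Fin.snoc_castSucc, Fin.snoc_last]
  rw [← Int.cast_smul_eq_zsmul ℝ, ← Int.cast_smul_eq_zsmul ℝ a, ← Int.cast_smul_eq_zsmul ℝ b,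
    MForm.wedge_smul_left, MForm.wedge_smul_right, smul_smul, Int.cast_mul]

/-- Symbol forms multiply, single tuple on the left. [folklore] -/
theorem symbolForm_mulChain_single (p : ℕ) (t : Fin p → M → ℂ) (a : ℤ) (u : (Fin 1 → M → ℂ) →₀ ℤ) :
    symbolForm E (p + 1) (mulChain p (Finsupp.single t a) u) =
      (symbolForm E p (Finsupp.single t a)).wedge (symbolForm E 1 u) := by
  induction u using Finsupp.induction with
  | zero => rw [mulChain_zero_right, symbolForm_zero, symbolForm_zero, MForm.wedge_zero]
  | single_add g b u _ _ ih =>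
    rw [mulChain_add_right, symbolForm_add, symbolForm_add, MForm.wedge_add_right, ih,
      symbolForm_mulChain_single_single]

/-- **Symbol forms multiply**: `symbolForm (s · u) = symbolForm s ∧ symbolForm u`
(`∧^{p+1} dlog` of a concatenated tuple peels off its last factor, `dlogWedge_succ`; both sides are
biadditive). [cite: GreenGriffiths2005TangentSpace, §6.3 (6.37)] -/
theorem symbolForm_mulChain (p : ℕ) (s : (Fin p → M → ℂ) →₀ ℤ) (u : (Fin 1 → M → ℂ) →₀ ℤ) :
    symbolForm E (p + 1) (mulChain p s u) = (symbolForm E p s).wedge (symbolForm E 1 u) := by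
  induction s using Finsupp.induction with
  | zero => rw [mulChain_zero_left, symbolForm_zero, symbolForm_zero, MForm.zero_wedge]
  | single_add t a s _ _ ih =>
    rw [mulChain_add_left, symbolForm_add, symbolForm_add, MForm.wedge_add_left, ih,
      symbolForm_mulChain_single]

end Chains

end CupStep

/-- STUB `stub_cupStepChains` (registered sub-goal of item stmt-HodgeConjecture-18702, anchoring this
helper file): **the Čech cup product of a Milnor symbol cocycle with a weight-one Milnor symbol
`1`-cocycle is a Milnor symbol cocycle** (`CupStep.isMilnorSymbolCocycle_cupChain`).
[cite: BottTu1982Forms, §8 (8.4)] [cite: Milnor1972, §11 Thm. 11.1] -/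
theorem stub_cupStepChains : ∀ {M E : Type*} [NormedAddCommGroup E] [NormedSpace ℂ E] [TopologicalSpace M] [ChartedSpace E M] {κ : Type*} {a p : ℕ} {V : κ → Set M} {x : (Fin (a + 1) → κ) → ((Fin p → M → ℂ) →₀ ℤ)} {y : (Fin 2 → κ) → ((Fin 1 → M → ℂ) →₀ ℤ)}, IsMilnorSymbolCocycle E V x → IsMilnorSymbolCocycle E V y → IsMilnorSymbolCocycle E V fun J : Fin (a + 2) → κ ↦ CupStep.mulChain p (x (J ∘ Fin.castSucc)) (y (Literature.AlgebraicGeometry.Modules.Cech.back a J)) :=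
  fun hx hy ↦ CupStep.isMilnorSymbolCocycle_cupChain hx hy

end Summit.HodgeConjecture.HodgeConjecture.Theorems.SymbolLiftR
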